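import Summits.BirchSwinnertonDyer.Rank1Residual.GaloisImage.HauptmodulDeltaUnitValuation
import Summits.BirchSwinnertonDyer.Rank1Residual.GaloisImage.WildThreeAdicTowerJForm
import Literature.NumberTheory.EllipticCurves.ModThreeReducibleIffPsi3Root
import Literature.NumberTheory.EllipticCurves.NonEisensteinPrimeOfSurjective
import HarnessLib

/-!
# Lemmas for the EXOTIC SIGNATURE after the Hauptmodul route: `j = 0 ⟹ ρ̄_{E,3}` not onto,
# a rational `3`-adic unit is `≡ c (mod 9)` for some `c` prime to `3`, and `num`-currency plumbing
# (cell `b2b-bsdres`, team n1011, seat p02 gen 6 — row T-b11-F4-END, file F4c-H25)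

HONEST FRAMING (cell `b2b-bsdres`, run/shared/lean/b2b/bsd-rank1-residual/, verbatim in every
file): the goal of the cell is to DELETE the COMBINATION-SHAPED residual classes of the
Birch–Swinnerton-Dyer formula for ALL analytic-rank `≤ 1` elliptic curves over `ℚ` — "full BSD
formula for every rank `≤ 1` curve in class `C`" assembled STRICTLY from published theorems — so
that the rank-`≤ 1` remainder becomes exactly the CONSTRUCTION-SHAPED classes, which are TYPED
(missing-input `Prop`s), NOT attempted. This is not "finishing BSD". Team n1011 (N10 / N11):
research route; no claim beyond the stated classes; labels UNCHANGED; nothing is booked. Theorems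
only (no definition, no named fact).

## What this file proves

* `isRoot_Ψ₃_of_c₄_eq_zero` — over any field of characteristic `0`: `c₄ = 0 ⟹ Ψ₃(−b₂/12) = 0`
  (`Ψ₃(−b₂/12) = −c₄²/2304 + (4b₈ − b₂b₆ + b₄²)/4`); hence
  **`not_surj_three_of_j_eq_zero`** — `j(E) = 0 ⟹ ρ̄_{E,3}` is NOT onto (the points above the
  rational root span a `Γ_ℚ`-stable line, `not_hasIrreducibleModPGaloisRep_three_of_isRoot_Ψ₃`,
  while onto is irreducible, `hasIrreducibleModPGaloisRep_of_hasSurjectiveModNGaloisRep`).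
* `nine_dvd_num_of_padicValRat` — `r = 0 ∨ 2 ≤ v₃(r) ⟹ 9 ∣ num(r)`;
  `nine_dvd_num_sub_of_dvd_sub` — `9 ∣ num(q − c)`, `9 ∣ c − c' ⟹ 9 ∣ num(q − c')`.
* `exists_nine_dvd_num_sub_of_padicValRat_eq_zero` — `q ≠ 0`, `v₃(q) = 0 ⟹ ∃ c ∈ ℤ`, `3 ∤ c`,
  `9 ∣ num(q − c)` (a rational `3`-adic unit has a residue `mod 9` prime to `3`).
* `three_le_padicValRat_of_padicValRat_sub_1728` — `v₃(j − 1728) = 3`, `j ≠ 0 ⟹ 3 ≤ v₃(j)`;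
  `padicValRat_sub_1728_ne_three_of_nine_dvd_num` — `9 ∣ num(j/27 − c)` with `3 ∣ c − 1 ⟹
  v₃(j − 1728) ≠ 3` (then `j/27 ≡ 64 (mod 3)` and `v₃(j − 1728) ≥ 4`, or `j = 1728`).

These feed `HauptmodulExoticSignature` (the dispatch of a failing tower over the eleven
Hauptmodul / wild-tower class theorems).  Nothing booked.

References: [Cremona1997] §3.8; [SilvermanAEC2009] III.4.12, Ex. 3.7; [Serre1972] §4.
-/

noncomputable section

open scoped Classical

namespace Summit.BirchSwinnertonDyer.Rank1Residual.GaloisImage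

open WeierstrassCurve Polynomial Literature.NumberTheory.EllipticCurves

/-! ### §1 `j = 0` curves have a rational root of `Ψ₃` -/

/-- **`c₄ = 0 ⟹ Ψ₃(−b₂/12) = 0`** over a field of characteristic `0`:
`Ψ₃(−b₂/12) = −(b₂² − 24b₄)²/2304 + (4b₈ − b₂b₆ + b₄²)/4 = −c₄²/2304`. [folklore] -/
theorem isRoot_Ψ₃_of_c₄_eq_zero {F : Type*} [Field F] [CharZero F] (V : WeierstrassCurve F)
    (h : V.c₄ = 0) : V.Ψ₃.IsRoot (-V.b₂ / 12) := by
  have hb := V.b_relation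
  have h4 : V.b₂ ^ 2 - 24 * V.b₄ = 0 := h
  rw [IsRoot.def, Ψ₃]
  simp only [eval_add, eval_mul, eval_pow, eval_C, eval_X, eval_ofNat]
  linear_combination (-(V.b₂ ^ 2 - 24 * V.b₄) / 2304) * h4 + (1 / 4 : F) * hb

/-- **No elliptic curve over `ℚ` with `j = 0` has `ρ̄_{E,3}` onto**: `c₄ = 0`, so `x₀ = −b₂/12 ∈ ℚ`
is a root of `Ψ₃`, the points above it span a `Γ_ℚ`-stable subgroup of order `3` of `E[3]`
(a rational `3`-isogeny), and an onto `ρ̄_{E,3}` is irreducible.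
[cite: Cremona1997, §3.8] [cite: SilvermanAEC2009, III.4.12 and Exercise 3.7] [cite: Serre1972, §4] -/
theorem not_surj_three_of_j_eq_zero (W : WeierstrassCurve ℚ) [W.IsElliptic] (hj : W.j = 0) :
    ¬ W.HasSurjectiveModNGaloisRep 3 := by
  intro hsurj
  haveI : Fact (Nat.Prime 3) := ⟨Nat.prime_three⟩
  haveI : NeZero ((3 : ℕ) : ℚ) := ⟨by norm_num⟩
  have hc4 : W.c₄ = 0 := (WeierstrassCurve.j_eq_zero_iff (W := W)).mp hj
  have hroot := isRoot_Ψ₃_of_c₄_eq_zero W hc4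
  have hirr := hasIrreducibleModPGaloisRep_of_hasSurjectiveModNGaloisRep W 3 (by exact_mod_cast hsurj)
  exact WeierstrassCurve.not_hasIrreducibleModPGaloisRep_three_of_isRoot_Ψ₃ W hroot hirr

/-- Contrapositive: `ρ̄_{E,3}` onto ⟹ `j(E) ≠ 0`. [cite: Serre1972, §4] -/
theorem j_ne_zero_of_surj_three (W : WeierstrassCurve ℚ) [W.IsElliptic]
    (hsurj : W.HasSurjectiveModNGaloisRep 3) : W.j ≠ 0 :=
  fun hj ↦ not_surj_three_of_j_eq_zero W hj hsurj

/-! ### §2 `num`-currency plumbing -/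

/-- `r = 0` or `2 ≤ v₃(r)` ⟹ `9 ∣ num(r)`. [folklore] -/
theorem nine_dvd_num_of_padicValRat {r : ℚ} (h : r = 0 ∨ 2 ≤ padicValRat 3 r) :
    (9 : ℤ) ∣ r.num := by
  haveI : Fact (Nat.Prime 3) := ⟨Nat.prime_three⟩
  rcases h with h0 | h2
  · rw [h0, Rat.num_zero]; exact dvd_zero 9
  · have hdef : padicValRat 3 r = padicValInt 3 r.num - padicValNat 3 r.den := rfl
    have hn : 2 ≤ padicValInt 3 r.num := by rw [hdef] at h2; omega
    have := (padicValInt_dvd_iff (p := 3) 2 r.num).mpr (Or.inr hn)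
    simpa using this

/-- `9 ∣ num(q − c)` and `9 ∣ c − c'` (integers `c, c'`) ⟹ `9 ∣ num(q − c')`. [folklore] -/
theorem nine_dvd_num_sub_of_dvd_sub {q : ℚ} {c c' : ℤ} (h : (9 : ℤ) ∣ (q - c).num)
    (hcc : (9 : ℤ) ∣ c - c') : (9 : ℤ) ∣ (q - c').num := by
  haveI : Fact (Nat.Prime 3) := ⟨Nat.prime_three⟩
  apply nine_dvd_num_of_padicValRat
  by_cases h0 : q - (c' : ℚ) = 0
  · exact Or.inl h0
  right
  have e : q - (c' : ℚ) = (q - c) + ((c - c' : ℤ) : ℚ) := by push_cast; ring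
  -- valuations of the two summands
  have h1 : q - (c : ℚ) = 0 ∨ 2 ≤ padicValRat 3 (q - c) := by
    by_cases hz : q - (c : ℚ) = 0
    · exact Or.inl hz
    · exact Or.inr (two_le_padicValRat_of_nine_dvd_num hz h)
  have h2 : ((c - c' : ℤ) : ℚ) = 0 ∨ 2 ≤ padicValRat 3 ((c - c' : ℤ) : ℚ) := by
    by_cases hz : c - c' = 0
    · left; rw [hz]; push_cast; ring
    · right
      rw [padicValRat.of_int]
      have := ((padicValInt_dvd_iff (p := 3) 2 (c - c')).mp (by simpa using hcc)).resolve_left hz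
      exact_mod_cast this
  rw [e]
  rcases h1 with h1 | h1
  · rw [h1, zero_add]
    rcases h2 with h2 | h2
    · exfalso; apply h0; rw [e, h1, h2, zero_add]
    · exact h2
  rcases h2 with h2 | h2
  · rw [h2, add_zero]; exact h1
  have hne : q - (c : ℚ) + ((c - c' : ℤ) : ℚ) ≠ 0 := by rw [← e]; exact h0
  exact le_trans (le_min h1 h2) (padicValRat.min_le_padicValRat_add (p := 3) hne)

/-- **A rational `3`-adic unit has a residue `mod 9` prime to `3`**: for `q ≠ 0` with `v₃(q) = 0`
there is `c ∈ ℤ` with `3 ∤ c` and `9 ∣ num(q − c)` (`c = num(q)·d'` with `d'` an inverse of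
`den(q)` modulo `9`; `q − c = q(1 − den(q)·d')`). [folklore] -/
theorem exists_nine_dvd_num_sub_of_padicValRat_eq_zero {q : ℚ} (hq : q ≠ 0)
    (hv : padicValRat 3 q = 0) : ∃ c : ℤ, ¬ (3 : ℤ) ∣ c ∧ (9 : ℤ) ∣ (q - c).num := by
  haveI : Fact (Nat.Prime 3) := ⟨Nat.prime_three⟩
  obtain ⟨hn, hd⟩ := not_dvd_num_den_of_padicValRat_eq_zero hq hv
  set a : ℤ := q.num with ha
  set b : ℤ := (q.den : ℤ) with hb
  have hb3 : ¬ (3 : ℤ) ∣ b := by rw [hb]; exact_mod_cast hd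
  -- an inverse of `b` modulo `9`
  obtain ⟨b', hb'⟩ : ∃ b' : ℤ, (9 : ℤ) ∣ b * b' - 1 := by
    have h9 : b % 9 = 1 ∨ b % 9 = 2 ∨ b % 9 = 4 ∨ b % 9 = 5 ∨ b % 9 = 7 ∨ b % 9 = 8 := by omega
    rcases h9 with h | h | h | h | h | h
    · exact ⟨1, by omega⟩
    · exact ⟨5, by omega⟩
    · exact ⟨7, by omega⟩
    · exact ⟨2, by omega⟩
    · exact ⟨4, by omega⟩
    · exact ⟨8, by omega⟩
  refine ⟨a * b', ?_, ?_⟩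
  · -- `3 ∤ a b'`
    intro h3
    have hb'3 : ¬ (3 : ℤ) ∣ b' := by
      intro hb'd
      have : (3 : ℤ) ∣ b * b' - 1 - b * b' := by
        have h91 : (3 : ℤ) ∣ b * b' - 1 := dvd_trans ⟨3, by norm_num⟩ hb'
        exact dvd_sub h91 (dvd_mul_of_dvd_right hb'd b)
      have e : b * b' - 1 - b * b' = -1 := by ring
      rw [e] at this
      omega
    rcases (Int.prime_three.dvd_mul).mp h3 with h | h
    · exact hn h
    · exact hb'3 h
  · -- `q − a b' = q (1 − b b')`
    have hqb : q * b = a := by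
      rw [ha, hb]; exact Rat.mul_den_eq_num q
    have e : q - ((a * b' : ℤ) : ℚ) = q * ((1 - b * b' : ℤ) : ℚ) := by
      push_cast
      linear_combination ((b' : ℚ)) * hqb
    apply nine_dvd_num_of_padicValRat
    by_cases hz : (1 - b * b' : ℤ) = 0
    · left; rw [e, hz]; push_cast; ring
    right
    rw [e, padicValRat.mul hq (by exact_mod_cast hz), hv, zero_add, padicValRat.of_int]
    have h9' : (9 : ℤ) ∣ 1 - b * b' := by
      have : 1 - b * b' = -(b * b' - 1) := by ring
      rw [this]; exact (dvd_neg).mpr hb'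
    have := ((padicValInt_dvd_iff (p := 3) 2 (1 - b * b')).mp (by simpa using h9')).resolve_left hz
    exact_mod_cast this

/-! ### §3 `v₃(j − 1728) = 3` versus `v₃(j)` -/

/-- `v₃(q − 1728) = 3` and `q ≠ 0` ⟹ `3 ≤ v₃(q)` (`v₃(1728) = 3`). [folklore] -/
theorem three_le_padicValRat_of_padicValRat_sub_1728 {q : ℚ} (hq : q ≠ 0)
    (h : padicValRat 3 (q - 1728) = 3) : 3 ≤ padicValRat 3 q := by
  haveI : Fact (Nat.Prime 3) := ⟨Nat.prime_three⟩
  have h1728 : padicValRat 3 (1728 : ℚ) = 3 := padicValRat_three_1728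
  have hne : q - 1728 + 1728 ≠ 0 := by rw [sub_add_cancel]; exact hq
  have hmin := padicValRat.min_le_padicValRat_add (p := 3) hne
  rw [sub_add_cancel, h, h1728, min_self] at hmin
  exact hmin

/-- **`9 ∣ num(q/27 − c)` with `c ≡ 1 (mod 3)` forces `v₃(q − 1728) ≠ 3`**: `q − 1728 =
27((q/27 − c) + (c − 64))` with `v₃(q/27 − c) ≥ 2` (or `= 0`) and `3 ∣ c − 64`, so either
`q = 1728` or `v₃(q − 1728) ≥ 4`. [folklore] -/
theorem padicValRat_sub_1728_ne_three_of_nine_dvd_num {q : ℚ} {c : ℤ}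
    (h : (9 : ℤ) ∣ (q / 27 - c).num) (hc : (3 : ℤ) ∣ c - 1) :
    padicValRat 3 (q - 1728) ≠ 3 := by
  haveI : Fact (Nat.Prime 3) := ⟨Nat.prime_three⟩
  intro h3
  have e : q - 1728 = 27 * ((q / 27 - c) + ((c - 64 : ℤ) : ℚ)) := by push_cast; ring
  by_cases h0 : (q / 27 - c) + ((c - 64 : ℤ) : ℚ) = 0
  · rw [e, h0, mul_zero, padicValRat.zero] at h3; norm_num at h3
  -- `v₃` of the inner sum is `≥ 1`
  have hinner : 1 ≤ padicValRat 3 ((q / 27 - c) + ((c - 64 : ℤ) : ℚ)) := by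
    have h2 : ((c - 64 : ℤ) : ℚ) = 0 ∨ 1 ≤ padicValRat 3 ((c - 64 : ℤ) : ℚ) := by
      by_cases hz : c - 64 = 0
      · left; rw [hz]; push_cast; ring
      · right
        rw [padicValRat.of_int]
        have hc64 : (3 : ℤ) ∣ c - 64 := by
          have : c - 64 = (c - 1) - 63 := by ring
          rw [this]; exact dvd_sub hc ⟨21, by norm_num⟩
        have := ((padicValInt_dvd_iff (p := 3) 1 (c - 64)).mp (by simpa using hc64)).resolve_left hz
        exact_mod_cast this
    by_cases h1 : q / 27 - (c : ℚ) = 0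
    · rw [h1, zero_add] at h0 ⊢
      rcases h2 with h2 | h2
      · exact absurd h2 h0
      · exact h2
    have hv1 : 1 ≤ padicValRat 3 (q / 27 - c) :=
      le_trans (by norm_num) (two_le_padicValRat_of_nine_dvd_num h1 h)
    rcases h2 with h2 | h2
    · rw [h2, add_zero]; exact hv1
    · exact le_trans (le_min hv1 h2) (padicValRat.min_le_padicValRat_add (p := 3) h0)
  have h27 : padicValRat 3 (27 : ℚ) = 3 := by
    have h33 : padicValRat 3 (3 : ℚ) = 1 := by exact_mod_cast padicValRat.self (p := 3) (by norm_num)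
    rw [show (27 : ℚ) = 3 ^ 3 by norm_num, padicValRat.pow, h33]
    all_goals norm_num
  rw [e, padicValRat.mul (by norm_num) h0, h27] at h3
  omega

end Summit.BirchSwinnertonDyer.Rank1Residual.GaloisImage
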